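import Literature.NumberTheory.Transcendental.AyoubRelativeStokes
import Literature.NumberTheory.Transcendental.AyoubRelativeSubst
import Literature.NumberTheory.Transcendental.AyoubRelativeFiniteRank

/-!
# Ayoub's relative Kontsevich–Zagier theorem revisited — pull-backs along closed loops
# (an infinite family of instances of Théorème 1.7 `⇒`)

Theorems only, on top of `Literature/NumberTheory/Transcendental/AyoubRelative.lean` (objects
`O k = 𝒪 = k[z, t, t⁻¹]`, `dz`, `restr`, `mapCoeff`, `Odagger k = 𝒪†_alg`, `ayoubGenerators`,
and the NAMED FACT `Literature.NumberTheory.Transcendental.AyoubRel.ayoub_relativeKZ_revisited`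
= Théorème 1.7 of J. Ayoub, *La version relative de la conjecture des périodes de
Kontsevich–Zagier revisitée*, Tohoku Math. J. (2) 71 (2019) 465–485), `…Stokes.lean` (Stokes on
the square as a relation, `zvar`, calculus), `…Subst.lean` (substitutions `z_l ↦ r`, chain rule)
and `…FiniteRank.lean` (`smul_mem_odagger'`).

Recall (`gens` = Ayoub's generators (a) `∂G/∂zᵢ - G|_{zᵢ=1} + G|_{zᵢ=0}`, (b) `tⱼ∂H/∂tⱼ`,
`G, H ∈ 𝒪†_alg`): Théorème 1.7 says `ker ∫ ∩ 𝒪†_alg = span_k gens`; `⊇` is proved in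
`AyoubRelative.lean`, `⊆` is the deep (motivic) content and stays a named fact. Its proved
sub-cases so far: `ϖ`-Laurent polynomials (`…Proofs.lean`), finite rank (`…FiniteRank.lean`), the
single infinite-rank series `∑ ϖⁿ(2z-1)^{2n+1}` (`…Stokes.lean`).

## What is proved here (elementary; not in the note)

**`loopPullback_mem_span`.** Let `l, i, j` be distinct indices, `E ∈ 𝒪†_alg` not involving
`zᵢ, zⱼ` (an algebraic "1-form `E du`" in `u = z_l`, any other variables being parameters), and
`φ ∈ 𝒪` not involving `z_l, zⱼ` with `φ|_{zᵢ=0} = φ|_{zᵢ=1}` (a CLOSED polynomial loop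
`u = φ(zᵢ, …)`, `zᵢ ∈ [0,1]`). Then the pull-back `φ^*(E du) = (∂ᵢφ) · E(z_l := φ) dzᵢ` is a
relation: `(∂ᵢφ) · E(z_l := φ) ∈ span_k gens` — over any field, with no integrality input. This
is an infinite-rank family (e.g. `E = 1/(1 - ϖz_l)`, `φ = (2zᵢ - 1)²` is `4 · oddGeom i`), i.e.
"`∮` of an algebraic form over a null-homotopic algebraic loop is a relation", the algebraic
counterpart of the change of variables + cancellation that Ayoub's formulation does not postulate
(Remarque 1.8). Certificate: Stokes on `[0,1]² ∋ (zᵢ, zⱼ)` (`…Stokes.mem_span_of_stokes_certificate`)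
for `d` of the (in general transcendental) primitive of `E du` pulled back along the linear
homotopy `q = zⱼ · φ|_{zᵢ=0} + (1 - zⱼ) · φ` from the loop (`zⱼ = 0`) to a constant (`zⱼ = 1`):
`K = (1 - zⱼ)(∂ᵢφ) · E(z_l := q)`, `L = (φ|_{zᵢ=0} - φ) · E(z_l := q)` are in `𝒪†_alg`
(`…Subst.mapCoeff_subst_mem_odagger`), `∂ⱼK = ∂ᵢL` (chain rule `…Subst.mapCoeff_dz_subst`),
`K|_{zⱼ=0} = (∂ᵢφ) · E(z_l := φ)`, `K|_{zⱼ=1} = L|_{zᵢ=0} = L|_{zᵢ=1} = 0`.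

"Does not involve `z`" is expressed as `f|_{z=0} = f` (coefficientwise for series).

**Non-vacuity** (`four_smul_oddGeom_mem_span`): the hypotheses are met by `E = 1/(1 - ϖ z_{i+1})`,
`φ = (2zᵢ - 1)²`, `j = i + 2`, and the theorem then yields `4 · oddGeom i ∈ span_k gens`
(`loopPullback_oddGeom` identifies the pull-back), the example of `…Stokes.lean`.

## References

* J. Ayoub, *La version relative de la conjecture des périodes de Kontsevich–Zagier revisitée*,
  Tohoku Math. J. (2) 71 (2019) 465–485 (doi:10.2748/tmj/1568772181; preprint `rel-KZ-bis.pdf`),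
  §1.2: Notation 1.6, Théorème 1.7, Remarque 1.8 (bib key `AyoubRelKZRevisited`).
* M. Kontsevich, D. Zagier, *Periods* (2001), §1.1.
-/

noncomputable section

namespace Literature.NumberTheory.Transcendental.AyoubRel

variable {k : Type} [Field k]

/-! ### 1. Coefficientwise operators and multiplication by polynomials -/

/-- A coefficientwise derivation and multiplication by `g ∈ 𝒪`: `D(g · S) = Dg · S + g · DS`.
[folklore] -/
theorem mapCoeff_smul_of_leibniz (D : O k →ₗ[k] O k)
    (hD : ∀ f g : O k, D (f * g) = D f * g + f * D g) (g : O k) (S : LaurentSeries (O k)) :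
    mapCoeff k D (g • S) = D g • S + g • mapCoeff k D S := by
  refine HahnSeries.ext (funext fun n => ?_)
  simp only [mapCoeff_coeff, HahnSeries.coeff_smul, HahnSeries.coeff_add', Pi.add_apply, smul_eq_mul,
    hD, mapCoeff_coeff]

/-- A coefficientwise multiplicative map and multiplication by `g ∈ 𝒪`: `ρ(g · S) = ρ(g) · ρ(S)`.
[folklore] -/
theorem mapCoeff_smul_of_map_mul (ρ : O k →ₗ[k] O k) (hρ : ∀ f g : O k, ρ (f * g) = ρ f * ρ g)
    (g : O k) (S : LaurentSeries (O k)) : mapCoeff k ρ (g • S) = ρ g • mapCoeff k ρ S := by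
  refine HahnSeries.ext (funext fun n => ?_)
  simp only [mapCoeff_coeff, HahnSeries.coeff_smul, smul_eq_mul, hρ]

/-! ### 2. Pull-backs of algebraic 1-forms along closed polynomial loops are relations -/

/-- **Théorème 1.7, direction `⇒`, for pull-backs along closed loops — proved** (over any field).
Let `l, i, j` be three distinct indices; let `E ∈ 𝒪†_alg` involve neither `zᵢ` nor `zⱼ`
(think of `E = E(u, …) du`, `u = z_l`, an algebraic 1-form in the variable `u` with parameters),
and let `φ ∈ 𝒪` involve neither `z_l` nor `zⱼ` (a polynomial loop `u = φ(zᵢ, …)`) be CLOSED: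
`φ|_{zᵢ=0} = φ|_{zᵢ=1}`. Then the pull-back `φ^*(E du) = E(z_l := φ) · ∂φ/∂zᵢ · dzᵢ`, i.e. the
series `F = (∂ᵢφ) · E(z_l := φ)`, lies in `span_k gens` (so `∫ F = 0`: `∮` of `E du` over the
null-homotopic loop `φ([0,1])` vanishes, coefficientwise `∫₀¹ e(φ)φ' dzᵢ = [ẽ(φ)]₀¹ = 0`).
The certificate is Stokes on the square `[0,1]² ∋ (zᵢ, zⱼ)` for `d` of the (transcendental)
primitive of `E` along the linear homotopy `q = zⱼ φ|_{zᵢ=0} + (1 - zⱼ) φ` from the loop to a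
constant: `K = (1-zⱼ) ∂ᵢφ · E(z_l := q)`, `L = (φ|_{zᵢ=0} - φ) · E(z_l := q)` are ALGEBRAIC, closed
(`∂ⱼK = ∂ᵢL`, chain rule), `K|_{zⱼ=0} = F`, and `K|_{zⱼ=1} = L|_{zᵢ=0} = L|_{zᵢ=1} = 0`.
Example: `E = 1/(1 - ϖ z_l)`, `φ = (2zᵢ-1)²` gives `4 · oddGeom i` of `…Stokes.lean`;
`φ = zᵢ(1-zᵢ) · p(zᵢ)` (`p` any polynomial) gives further infinite-rank instances.
[Ayoub, revisited note, Théorème 1.7 (⇒), loop-pullback instances] [folklore] -/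
theorem loopPullback_mem_span {l i j : ℕ} (hli : l ≠ i) (hlj : l ≠ j) (hij : i ≠ j)
    {E : LaurentSeries (O k)} (hE : E ∈ Odagger k) (hEi : mapCoeff k (restr k i 0) E = E)
    (hEj : mapCoeff k (restr k j 0) E = E) {φ : O k} (hφl : restr k l 0 φ = φ)
    (hφj : restr k j 0 φ = φ) (hloop : restr k i 0 φ = restr k i 1 φ) :
    dz k i φ • mapCoeff k (subst k l φ).toLinearMap E ∈ Submodule.span k (ayoubGenerators k) := by
  -- notation: `φ₀ = φ|_{zᵢ=0}`, the homotopy `q`, and `S = E(z_l := q)`, `S' = (∂_l E)(z_l := q)`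
  set q : O k := zvar k j * restr k i 0 φ + (1 - zvar k j) * φ with hq
  set S : LaurentSeries (O k) := mapCoeff k (subst k l q).toLinearMap E with hS
  set S' : LaurentSeries (O k) := mapCoeff k (subst k l q).toLinearMap (mapCoeff k (dz k l) E)
    with hS'
  -- freeness bookkeeping (`f|_{z=0} = f` says "`f` does not involve `z`")
  have hφ₀i : restr k i 0 (restr k i 0 φ) = restr k i 0 φ :=
    LinearMap.congr_fun (restr_comp_restr_zero i 0) φ
  have hφ₀i1 : restr k i 1 (restr k i 0 φ) = restr k i 0 φ := restr_of_restr_eq i 1 hφ₀i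
  have hφ₀j : restr k j 0 (restr k i 0 φ) = restr k i 0 φ := restr_zero_restr_of_restr_eq hij 0 hφj
  have hφ₀l : restr k l 0 (restr k i 0 φ) = restr k i 0 φ :=
    restr_zero_restr_of_restr_eq hli.symm 0 hφl
  have hφ'j : restr k j 0 (dz k i φ) = dz k i φ := restr_zero_dz_of_restr_eq hij hφj
  have hzjl : restr k l 0 (zvar k j) = zvar k j := restr_zvar_of_ne hlj.symm 0
  have hql : restr k l 0 q = q := by
    rw [hq, map_add, restr_mul, restr_mul, map_sub, restr_one, hzjl, hφ₀l, hφl]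
  have hdjq : dz k j q = restr k i 0 φ - φ := by
    rw [hq, map_add, dz_mul, dz_mul, map_sub, dz_one, dz_zvar_self, dz_of_restr_eq j hφ₀j,
      dz_of_restr_eq j hφj]
    ring
  have hdiq : dz k i q = (1 - zvar k j) * dz k i φ := by
    rw [hq, map_add, dz_mul, dz_mul, map_sub, dz_one, dz_zvar_of_ne hij.symm, dz_of_restr_eq i hφ₀i]
    ring
  have hrjq : restr k j 0 q = φ := by
    rw [hq, map_add, restr_mul, restr_mul, map_sub, restr_one, restr_zvar_self, map_zero, hφ₀j, hφj]
    ring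
  have hSalg : S ∈ Odagger k := mapCoeff_subst_mem_odagger l hql hE
  -- the certificate
  refine mem_span_of_stokes_certificate i j (K := ((1 - zvar k j) * dz k i φ) • S)
    (L := (restr k i 0 φ - φ) • S) (smul_mem_odagger' _ hSalg) (smul_mem_odagger' _ hSalg)
    ?_ ?_ ?_ ?_ ?_
  · -- closedness `∂ⱼ K = ∂ᵢ L` (chain rule)
    have hjS : mapCoeff k (dz k j) S = dz k j q • S' := mapCoeff_dz_subst l j q hEj
    have hiS : mapCoeff k (dz k i) S = dz k i q • S' := mapCoeff_dz_subst l i q hEi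
    have hdK : dz k j ((1 - zvar k j) * dz k i φ) = -dz k i φ := by
      rw [dz_mul, map_sub, dz_one, dz_zvar_self, dz_of_restr_eq j hφ'j]; ring
    have hdL : dz k i (restr k i 0 φ - φ) = -dz k i φ := by
      rw [map_sub, dz_of_restr_eq i hφ₀i]; ring
    rw [mapCoeff_smul_of_leibniz _ (dz_mul j), mapCoeff_smul_of_leibniz _ (dz_mul i), hjS, hiS,
      hdjq, hdiq, hdK, hdL, smul_smul, smul_smul]
    congr 2
    ring
  · -- `K|_{zⱼ=0} = F`
    rw [mapCoeff_smul_of_map_mul _ (restr_mul j 0), hS, mapCoeff_restr_subst hlj.symm, hrjq, hEj,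
      restr_mul, map_sub, restr_one, restr_zvar_self, map_zero, sub_zero, one_mul, hφ'j]
  · -- `K|_{zⱼ=1} = 0`
    rw [mapCoeff_smul_of_map_mul _ (restr_mul j 1), restr_mul, map_sub, restr_one, restr_zvar_self,
      map_one, sub_self, zero_mul, zero_smul]
  · -- `L|_{zᵢ=0} = 0`
    rw [mapCoeff_smul_of_map_mul _ (restr_mul i 0), map_sub, hφ₀i, sub_self, zero_smul]
  · -- `L|_{zᵢ=1} = 0`
    rw [mapCoeff_smul_of_map_mul _ (restr_mul i 1), map_sub, hφ₀i1, ← hloop, sub_self, zero_smul]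

/-- … hence such pull-backs have vanishing term-by-term integral. [folklore] -/
theorem intLaurent_loopPullback [CharZero k] {l i j : ℕ} (hli : l ≠ i) (hlj : l ≠ j) (hij : i ≠ j)
    {E : LaurentSeries (O k)} (hE : E ∈ Odagger k) (hEi : mapCoeff k (restr k i 0) E = E)
    (hEj : mapCoeff k (restr k j 0) E = E) {φ : O k} (hφl : restr k l 0 φ = φ)
    (hφj : restr k j 0 φ = φ) (hloop : restr k i 0 φ = restr k i 1 φ) :
    intLaurent k (dz k i φ • mapCoeff k (subst k l φ).toLinearMap E) = 0 :=
  ayoub_relativeKZ_revisited_easy k _ (loopPullback_mem_span hli hlj hij hE hEi hEj hφl hφj hloop)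

/-! ### 3. Non-vacuity: the loop theorem recovers the example of `…Stokes.lean` -/

/-- Restriction in a variable not occurring in `a, q` fixes the geometric series `a/(1 - ϖq)`.
[folklore] -/
theorem mapCoeff_restr_geomSeries (i : ℕ) (c : k) {a q : O k} (ha : restr k i 0 a = a)
    (hq : restr k i 0 q = q) : mapCoeff k (restr k i c) (geomSeries k a q) = geomSeries k a q := by
  refine hahnSeries_ext_of_natCast (fun n => ?_) (fun n => geomSeries_coeff_negSucc a q n) (fun n => ?_)
  · rw [mapCoeff_coeff, geomSeries_coeff_negSucc, map_zero]
  · rw [mapCoeff_coeff, geomSeries_coeff_natCast, restr_mul, restr_pow, restr_of_restr_eq i c ha,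
      restr_of_restr_eq i c hq]

/-- The data of the example: `E = 1/(1 - ϖ z_l)` pulled back along the closed loop
`u = (2zᵢ - 1)²` is `4 · ∑ₙ ϖⁿ (2zᵢ-1)^{2n+1} = 4 · oddGeom i`. [folklore] -/
theorem loopPullback_oddGeom (l i : ℕ) :
    dz k i ((2 * zvar k i - 1) ^ 2) •
        mapCoeff k (subst k l ((2 * zvar k i - 1) ^ 2)).toLinearMap (geomSeries k 1 (zvar k l)) =
      (4 : O k) • oddGeom k i := by
  have hd : dz k i ((2 * zvar k i - 1) ^ 2) = 4 * (2 * zvar k i - 1) := by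
    rw [dz_pow_succ, pow_one, map_sub, dz_mul, dz_ofNat, dz_zvar_self, dz_one]; ring
  rw [hd]
  refine hahnSeries_ext_of_natCast (fun n => ?_) (fun n => ?_) (fun n => ?_)
  · rw [HahnSeries.coeff_smul, mapCoeff_coeff, geomSeries_coeff_negSucc, map_zero, smul_zero]
  · rw [oddGeom, HahnSeries.coeff_smul, geomSeries_coeff_negSucc, smul_zero]
  · rw [HahnSeries.coeff_smul, mapCoeff_coeff, geomSeries_coeff_natCast, oddGeom, HahnSeries.coeff_smul,
      geomSeries_coeff_natCast, AlgHom.toLinearMap_apply, map_mul, map_one,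
      map_pow (subst k l ((2 * zvar k i - 1) ^ 2)), subst_zvar_self, smul_eq_mul, smul_eq_mul]
    ring

/-- **The loop theorem applies to the example** (its hypotheses are met by `E = 1/(1 - ϖz_l)`,
`φ = (2zᵢ-1)²`, with `l = i + 1`, `j = i + 2`), recovering `4 · oddGeom i ∈ span_k gens`
(cf. `oddGeom_mem_span_ayoubGenerators` of `…Stokes.lean`, proved there by the explicit rational
certificate). [folklore] -/
theorem four_smul_oddGeom_mem_span (i : ℕ) :
    (4 : O k) • oddGeom k i ∈ Submodule.span k (ayoubGenerators k) := by
  have hli : i + 1 ≠ i := Nat.succ_ne_self i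
  have hlj : i + 1 ≠ i + 2 := by omega
  have hij : i ≠ i + 2 := by omega
  -- `φ = (2zᵢ - 1)²` restricted in the three variables
  have hφ : ∀ (m : ℕ) (c : k), m ≠ i → restr k m c ((2 * zvar k i - 1) ^ 2) = (2 * zvar k i - 1) ^ 2 :=
    fun m c hm => by rw [restr_pow, map_sub, restr_mul, restr_ofNat, restr_zvar_of_ne hm.symm, restr_one]
  have hφi : ∀ c : k, restr k i c ((2 * zvar k i - 1) ^ 2) = (2 * algebraMap k (O k) c - 1) ^ 2 :=
    fun c => by rw [restr_pow, map_sub, restr_mul, restr_ofNat, restr_zvar_self, restr_one]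
  have hloop : restr k i 0 ((2 * zvar k i - 1) ^ 2) = restr k i 1 ((2 * zvar k i - 1) ^ 2) := by
    rw [hφi, hφi, map_zero, map_one]; ring
  -- `E = 1/(1 - ϖ z_l)` does not involve `zᵢ`, `zⱼ`
  have hE : ∀ m : ℕ, m ≠ i + 1 →
      mapCoeff k (restr k m 0) (geomSeries k 1 (zvar k (i + 1))) = geomSeries k 1 (zvar k (i + 1)) :=
    fun m hm => mapCoeff_restr_geomSeries m 0 (restr_one m 0) (restr_zvar_of_ne (Ne.symm hm) 0)
  rw [← loopPullback_oddGeom (i + 1) i]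
  exact loopPullback_mem_span hli hlj hij (geomSeries_mem_odagger _ _) (hE i hli.symm)
    (hE (i + 2) (by omega)) (hφ (i + 1) 0 hli) (hφ (i + 2) 0 (by omega)) hloop

end Literature.NumberTheory.Transcendental.AyoubRel
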